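import Summits.NavierStokesRegularity.NavierStokesRegularity.Theorems.OddMorawetzLocal.Negative.OddMorawetzLocalRefutationDefsIV
import Summits.NavierStokesRegularity.NavierStokesRegularity.Theorems.OddMorawetzOddMorawetzLocalPgvJetsIbp
import Summits.NavierStokesRegularity.NavierStokesRegularity.Theorems.OddMorawetzOddMorawetzLocalDensCalculus
import Summits.NavierStokesRegularity.NavierStokesRegularity.Theorems.OddMorawetzOddMorawetzLocalActMatrixSemantics
import Summits.NavierStokesRegularity.NavierStokesRegularity.Theorems.OddMorawetzOddMorawetzLocalIdxComplete
import Literature.Analysis.Calculus.IteratedFDerivSymmetric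
import HarnessLib

/-!
# Crux `OddMorawetzLocal` (stmt-NavierStokesRegularity-1376), refutation — coefficient vectors are determined by
their densities on symmetric jets

Stub `densV_injective` of the refutation skeleton of `OddMorawetzLocal` (line `registered`, lead c1), together with
the two membership lemmas the assembly needs: the 3-jet of a smooth field is a symmetric jet (`jet_mem_symmJets`,
Schwarz–Clairaut in the tree's all-orders form `Literature.Analysis.Calculus.iteratedFDeriv_comp_perm_of_contDiff`)
and the jet action of a linear isometry preserves symmetric jets (`jetAct_mem_symmJets`).

`densV_injective`: if the density `densV k τ = Σ_i τ i · Π_{v ∈ idx k [i]} coord v` of a coefficient vector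
`τ : V k` vanishes on the submodule `symmJets`, then `τ = 0`.  Proof:

* realisation (`exists_symmJet_coord`): every assignment `c` of the sorted jet coordinates of order `≤ 3` is the
  3-jet at the origin of a POLYNOMIAL field `pgv 0 P` (`jetVal_pgv` with rate `k = 0`, where `dg 0 j = ∂_j`):
  `∂^l (P a)(0) = coeff 0 (∂^l P a) = κ_l · coeff [l] (P a)` with a universal positive integer `κ_l`
  (`coeff_dgList_zero`, from Mathlib's `MvPolynomial.coeff_pderiv`), and the monomials `x^[l]` of distinct sorted
  `l` are distinct, so `P a := Σ_l (c (a,l) / κ_l) x^[l]` works (`exists_P3_coeff`);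
* algebra: hence the cubic form `c ↦ Σ_i τ i Π_{v ∈ idx k [i]} c v` vanishes identically, i.e. the polynomial
  `Σ_i monomial [idx k [i]] (τ i) ∈ MvPolynomial JVar ℝ` has all values zero, so it is zero (`MvPolynomial.funext`,
  `ℝ` infinite); its coefficients are the `τ i` because distinct basis monomials have distinct multisets of
  variables (`canonical_of_mem_idx`, `sortVars_eq_of_perm`, `nodup_idx`).

Mathlib + the landed support files (`jetVal_pgv`, `contDiff_pgv`, `jetVal_eq_coord`, `evalA_polyOfV`,
`canonical_of_mem_idx`, `nodup_idx`, `mem_sortedIdxFrom_iff`, `sortIdx_eq_self_iff`); no definitions, no named facts.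
-/

noncomputable section

open MvPolynomial

set_option linter.dupNamespace false
set_option autoImplicit false

namespace Summit.NavierStokesRegularity.NavierStokesRegularity.Theorems.OddMorawetz

/-! ### Symmetric jets: jets of smooth fields, invariance under the jet action -/

/-- **The 3-jet of a smooth field is a symmetric jet** (Schwarz–Clairaut at orders `2` and `3`). -/
theorem jet_mem_symmJets (u : EuclideanSpace ℝ (Fin 3) → EuclideanSpace ℝ (Fin 3)) (hu : ContDiff ℝ (⊤ : ℕ∞) u)
    (x : EuclideanSpace ℝ (Fin 3)) :
    ((u x, iteratedFDeriv ℝ 1 u x, iteratedFDeriv ℝ 2 u x, iteratedFDeriv ℝ 3 u x) : Jet3) ∈ symmJets :=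
  ⟨fun w σ => Literature.Analysis.Calculus.iteratedFDeriv_comp_perm_of_contDiff hu
      (WithTop.coe_le_coe.2 le_top) x w σ,
    fun w σ => Literature.Analysis.Calculus.iteratedFDeriv_comp_perm_of_contDiff hu
      (WithTop.coe_le_coe.2 le_top) x w σ⟩

/-- **The jet action of a linear isometry preserves symmetric jets**: `mlAct R n A = R ∘ A ∘ (R⁻¹, …, R⁻¹)`
commutes with permutations of the slots. -/
theorem jetAct_mem_symmJets (R : EuclideanSpace ℝ (Fin 3) ≃ₗᵢ[ℝ] EuclideanSpace ℝ (Fin 3)) {z : Jet3}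
    (hz : z ∈ symmJets) : jetAct R z ∈ symmJets := by
  have hz' : (∀ (w : Fin 2 → EuclideanSpace ℝ (Fin 3)) (σ : Equiv.Perm (Fin 2)), z.2.2.1 (w ∘ σ) = z.2.2.1 w) ∧
      (∀ (w : Fin 3 → EuclideanSpace ℝ (Fin 3)) (σ : Equiv.Perm (Fin 3)), z.2.2.2 (w ∘ σ) = z.2.2.2 w) := hz
  rw [jetAct_apply]
  refine ⟨fun w σ => ?_, fun w σ => ?_⟩
  · show mlAct R 2 z.2.2.1 (w ∘ σ) = mlAct R 2 z.2.2.1 w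
    rw [mlAct_apply, mlAct_apply]
    exact congrArg R (hz'.1 (fun s => R.symm (w s)) σ)
  · show mlAct R 3 z.2.2.2 (w ∘ σ) = mlAct R 3 z.2.2.2 w
    rw [mlAct_apply, mlAct_apply]
    exact congrArg R (hz'.2 (fun s => R.symm (w s)) σ)

/-! ### Monomials of a list of variables -/

/-- The product of the variables of a list is the monomial of its multiset. -/
theorem prod_map_X_eq_monomial {σ : Type*} [DecidableEq σ] (m : List σ) :
    ((m.map X).prod : MvPolynomial σ ℝ) = monomial (Multiset.toFinsupp (m : Multiset σ)) 1 := by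
  induction m with
  | nil => simp
  | cons v m ih =>
    rw [List.map_cons, List.prod_cons, ih, ← Multiset.cons_coe, ← Multiset.singleton_add, Multiset.toFinsupp_add,
      Multiset.toFinsupp_singleton, X, monomial_mul, one_mul]

/-- Evaluation of the monomial of a list of variables: `eval c (a · x^[m]) = a · Π_{v ∈ m} c v`. -/
theorem eval_monomial_coe {σ : Type*} [DecidableEq σ] (c : σ → ℝ) (m : List σ) (a : ℝ) :
    eval c (monomial (Multiset.toFinsupp (m : Multiset σ)) a) = a * (m.map c).prod := by
  have h1 : monomial (Multiset.toFinsupp (m : Multiset σ)) a = C a * ((m.map X).prod : MvPolynomial σ ℝ) := by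
    rw [prod_map_X_eq_monomial, C_mul_monomial, mul_one]
  rw [h1, map_mul, eval_C, map_list_prod, List.map_map]
  congr 1
  simp [Function.comp_def]

/-! ### Jets of polynomial fields at the origin -/

/-- At rate `0` the conjugated derivative is the plain partial derivative: `dg 0 j = ∂_j`. -/
theorem dg_zero (j : Fin 3) (p : P3) : dg 0 j p = pderiv j p := by
  simp [dg]

/-- **Coefficients of iterated derivatives**: `coeff m (∂^l p) = κ · coeff (m + [l]) p` for a positive integer `κ`
depending only on `l` and `m` (iterate Mathlib's `coeff_pderiv`). -/
theorem coeff_dgList_zero (l : List (Fin 3)) :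
    ∀ m : Fin 3 →₀ ℕ, ∃ κ : ℕ, 0 < κ ∧ ∀ p : P3,
      coeff m (dgList 0 l p) = κ * coeff (m + Multiset.toFinsupp (l : Multiset (Fin 3))) p := by
  induction l with
  | nil =>
    intro m
    refine ⟨1, Nat.one_pos, fun p => ?_⟩
    simp
  | cons i l ih =>
    intro m
    obtain ⟨κ, hκ, h⟩ := ih (m + Finsupp.single i 1)
    refine ⟨(m i + 1) * κ, Nat.mul_pos (Nat.succ_pos _) hκ, fun p => ?_⟩
    rw [dgList_cons, dg_zero, coeff_pderiv, h p, ← Multiset.cons_coe, ← Multiset.singleton_add,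
      Multiset.toFinsupp_add, Multiset.toFinsupp_singleton, add_assoc]
    push_cast
    ring

/-- The value at the origin of a polynomial field of rate `0` is the constant coefficient. -/
theorem pg_zero_apply_zero (q : P3) : pg 0 q 0 = coeff 0 q := by
  simp only [pg, pev, PiLp.zero_apply, Nat.cast_zero, neg_zero, zero_mul, Real.exp_zero, mul_one]
  rw [eval_zero', constantCoeff_eq]

/-- **Polynomial vectors with prescribed low coefficients**: for any data `b a l` there is `P : Fin 3 → P3` whose
coefficient of `x^[l]` in `P a` is `b a l` for every sorted `l` of length `≤ 3` (distinct sorted lists have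
distinct multisets). -/
theorem exists_P3_coeff (b : Fin 3 → List (Fin 3) → ℝ) :
    ∃ P : Fin 3 → P3, ∀ (a : Fin 3) (l : List (Fin 3)), l.Pairwise (· ≤ ·) → l.length ≤ 3 →
      coeff (Multiset.toFinsupp (l : Multiset (Fin 3))) (P a) = b a l := by
  -- the sorted index lists of length `≤ 3`
  set L : List (List (Fin 3)) := (List.range 4).flatMap fun n => sortedIdx n with hL
  have hmemL : ∀ l : List (Fin 3), l ∈ L.toFinset ↔ l.length ≤ 3 ∧ l.Pairwise (· ≤ ·) := by
    intro l
    rw [List.mem_toFinset, hL, List.mem_flatMap]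
    constructor
    · rintro ⟨n, hn, hl⟩
      rw [List.mem_range] at hn
      obtain ⟨hlen, hsort, -⟩ := mem_sortedIdxFrom_iff.1 hl
      exact ⟨by omega, hsort⟩
    · rintro ⟨hlen, hsort⟩
      exact ⟨l.length, List.mem_range.2 (by omega),
        mem_sortedIdxFrom_iff.2 ⟨rfl, hsort, fun x _ => Fin.zero_le x⟩⟩
  refine ⟨fun a => ∑ l ∈ L.toFinset, b a l • monomial (Multiset.toFinsupp (l : Multiset (Fin 3))) (1 : ℝ),
    fun a l hsort hlen => ?_⟩
  simp only [coeff_sum, coeff_smul, coeff_monomial, smul_eq_mul, mul_ite, mul_one, mul_zero]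
  rw [Finset.sum_eq_single l, if_pos rfl]
  · intro l' hl' hne
    rw [if_neg]
    intro e
    exact hne ((Multiset.coe_eq_coe.1 (Multiset.toFinsupp.injective e)).eq_of_pairwise
      (fun _ _ _ _ h₁ h₂ => le_antisymm h₁ h₂) ((hmemL l').1 hl').2 hsort)
  · intro hl
    exact absurd ((hmemL l).2 ⟨hlen, hsort⟩) hl

/-- **Realisation of jet coordinates by polynomial fields**: every assignment of the sorted jet coordinates of
order `≤ 3` is attained by a symmetric jet (the 3-jet at the origin of a polynomial field). -/
theorem exists_symmJet_coord (c : JVar → ℝ) :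
    ∃ z ∈ symmJets, ∀ w : JVar, sortIdx w.2 = w.2 → w.2.length ≤ 3 → JVar.coord w z = c w := by
  -- universal constants `κ_l > 0` with `coeff 0 (∂^l p) = κ_l · coeff [l] p`
  have hκ : ∀ l : List (Fin 3), ∃ κ : ℕ, 0 < κ ∧ ∀ p : P3,
      coeff 0 (dgList 0 l p) = κ * coeff (Multiset.toFinsupp (l : Multiset (Fin 3))) p := by
    intro l
    obtain ⟨κ, hκ, h⟩ := coeff_dgList_zero l 0
    exact ⟨κ, hκ, fun p => by rw [h p, zero_add]⟩
  choose κ hκpos hκ using hκ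
  obtain ⟨P, hP⟩ := exists_P3_coeff fun a l => c (a, l) / κ l
  refine ⟨(pgv 0 P 0, iteratedFDeriv ℝ 1 (pgv 0 P) 0, iteratedFDeriv ℝ 2 (pgv 0 P) 0, iteratedFDeriv ℝ 3 (pgv 0 P) 0),
    jet_mem_symmJets _ (contDiff_pgv 0 P) 0, ?_⟩
  rintro ⟨a, l⟩ hsort hlen
  have hsorted : l.Pairwise (· ≤ ·) := (sortIdx_eq_self_iff l).1 hsort
  rw [← jetVal_eq_coord (pgv 0 P) 0 (a, l) hlen, jetVal_pgv, pg_zero_apply_zero, hκ l, hP a l hsorted hlen]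
  have hne : (κ l : ℝ) ≠ 0 := Nat.cast_ne_zero.2 (hκpos l).ne'
  field_simp

/-! ### The registered stub -/

/-- **Stub `densV_injective`** (refutation of crux `OddMorawetzLocal`): a coefficient vector on the monomial basis
`idx k` whose density vanishes on all symmetric jets is zero — coefficient vectors are determined by their
densities on `symmJets` (the 3-jets of smooth fields). -/
theorem densV_injective (k : ℕ) (τ : V k) (h : ∀ z : Jet3, z ∈ symmJets → densV k τ z = 0) : τ = 0 := by
  -- Step 1: the cubic form of `τ` vanishes at every assignment of the variables
  have hF : ∀ c : JVar → ℝ, ∑ i, τ i * (((idx k).get i).map c).prod = 0 := by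
    intro c
    obtain ⟨z, hz, hc⟩ := exists_symmJet_coord c
    have h0 : JPoly.evalA (polyOfV k τ) (fun v => JVar.coord v z) = 0 := h z hz
    rw [evalA_polyOfV] at h0
    rw [← h0]
    refine Finset.sum_congr rfl fun i _ => ?_
    obtain ⟨-, -, hcan, -⟩ := canonical_of_mem_idx ((idx k).get_mem i)
    exact congrArg (fun l : List ℝ => τ i * l.prod)
      (List.map_congr_left fun v hv => (hc v (hcan v hv).1 (hcan v hv).2).symm)
  -- Step 2: the polynomial `Σ_i τ i x^[idx k [i]]` vanishes
  have hΦ : (∑ i, monomial (Multiset.toFinsupp (((idx k).get i : List JVar) : Multiset JVar)) (τ i) :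
      MvPolynomial JVar ℝ) = 0 := by
    refine MvPolynomial.funext fun c => ?_
    rw [map_sum, map_zero]
    simp only [eval_monomial_coe]
    exact hF c
  -- Step 3: distinct basis monomials have distinct multisets; read off the coefficients
  have hinj : ∀ i j : Fin (idx k).length,
      Multiset.toFinsupp (((idx k).get i : List JVar) : Multiset JVar) =
        Multiset.toFinsupp (((idx k).get j : List JVar) : Multiset JVar) → i = j := by
    intro i j e
    have hs := sortVars_eq_of_perm (Multiset.coe_eq_coe.1 (Multiset.toFinsupp.injective e))
    rw [(canonical_of_mem_idx ((idx k).get_mem i)).1, (canonical_of_mem_idx ((idx k).get_mem j)).1] at hs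
    exact List.nodup_iff_injective_get.1 (nodup_idx k) hs
  funext j
  have hj := congrArg (coeff (Multiset.toFinsupp (((idx k).get j : List JVar) : Multiset JVar))) hΦ
  rw [coeff_sum, coeff_zero, Finset.sum_eq_single j] at hj
  · simpa using hj
  · intro i _ hij
    rw [coeff_monomial, if_neg fun e => hij (hinj i j e)]
  · exact fun hj' => absurd (Finset.mem_univ j) hj'

end Summit.NavierStokesRegularity.NavierStokesRegularity.Theorems.OddMorawetz

end
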